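import Literature.NumberTheory.EllipticCurves.PoonenRainsPolar
import Literature.NumberTheory.EllipticCurves.PoonenRainsKummerIsotropyClass
import Literature.NumberTheory.EllipticCurves.WeilPairingTateDual
import Literature.NumberTheory.EllipticCurves.LocalKummerIsotropyTransport
import Literature.NumberTheory.GaloisCohomology.ArchimedeanInvariantMap
import HarnessLib

/-!
# The Poonen–Rains Tate quadratic form at `2` over a number field: the datum (e₂, q_v) with (Q1), (Q2)

For an elliptic curve `E/K` over a number field (model `W`, `h2 : (2 : K) ≠ 0`) this file packages the
explicit Poonen–Rains construction of the tree (`PoonenRainsCocycle`, `…Polar`, `…KummerIsotropyClass`) in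
the currency of the Klagsbrun–Mazur–Rubin bridge (`LocalInvariants`, `weilContPairingLocal`,
`kummerSelmerStructure`, level spelled `((2 : ℕ) : ℤ)`):

* `prWeil W h2 : E[2] × E[2] → K̄` — THE Weil pairing `e₂` (commutator pairing of the Heisenberg group;
  `= −1` iff the arguments are distinct and nonzero) with its six properties `prWeil_sq`, `prWeil_add_left`,
  `prWeil_add_right`, `smul_prWeil`, `prWeil_self`, `eq_zero_of_prWeil_eq_one`;
* `prForm W h2 v : H¹(K_v, E[2]) → ℤ/2`, `x ↦ inv_v(q_{K_v}(x))` for THE canonical invariant maps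
  `LocalInvariants.canonical K 2` (Poonen–Rains' Tate quadratic form `q_v`, PR Thm. 4.14 / KMR Def. 3.2);
* **(Q1) `prForm_add`** — `q_v(x + y) = q_v(x) + q_v(y) + inv_v(x ∪_{e₂} y)` with the cup product of the
  tree's `weilContPairingLocal W 2 prWeil …` (`prClass_add` + identification of the two pairings);
* **(Q2) `prForm_eq_zero_of_mem_kummer`** — `q_v` vanishes on the Kummer condition `𝓚_v = im(E(K_v)/2)`
  (`prClass_localKummerClass` + exactness `exists_eq_localKummerClass_of_mem`).

Reciprocity (Q3) is `sumInvLocalizationEqZero_canonical_of_numberField` applied to the global class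
(route file `GenusKolyvaginAtTwoKramerParityReciprocity`); twist invariance (Q4) is the object of the sequel.
References: [PoonenRains2012] §4.1, Cor. 4.6, Prop. 4.8, Thm. 4.14; [KlagsbrunMazurRubin2013] Def. 3.2–3.3,
Lemma 5.2; [MilneADT2006] I §1–§2.  No named fact is introduced.
-/

set_option autoImplicit false

noncomputable section

open scoped Classical

namespace Literature.NumberTheory.EllipticCurves

namespace ThetaLevelTwo

open _root_.WeierstrassCurve Field NumberField
open Literature.Algebra.Homology
open Literature.NumberTheory.GaloisRepresentations Literature.NumberTheory.GaloisRepresentations.DiscreteGaloisModule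
open Literature.NumberTheory.GaloisCohomology (LocalInvariants)
open Literature.NumberTheory.EllipticCurves.DokchitserDokchitser2012 (vec idx frame T eq_zero_or_eq_T)

universe u

section Weil

variable {K : Type u} [Field K] (W : WeierstrassCurve K) [W.IsElliptic] (h2 : (2 : K) ≠ 0)

/-! ### The Weil pairing `e₂` with values in `K̄` -/

/-- **The level-`2` Weil pairing** `e₂ : E[2] × E[2] → K̄`: the commutator pairing of the Heisenberg group
of `(E, 𝓞(2·O))` read in `K̄ˣ ⊂ K̄` (`−1` iff the arguments are distinct and nonzero).
[cite: PoonenRains2012, Prop. 4.5 (c) (the commutator pairing of the Heisenberg group is e_λ)] -/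
def prWeil (S T : geomTorsion W 2) : AlgebraicClosure K :=
  ((Additive.toMul ((heisenbergGm W h2).commForm S T) : (AlgebraicClosure K)ˣ) : AlgebraicClosure K)

/-- `e₂(S, T) = −1` for distinct nonzero `S, T`. [cite: PoonenRains2012, Prop. 4.5 (c) (the commutator pairing of the Heisenberg group is e_λ)] -/
theorem prWeil_of_ne {S T : geomTorsion W 2} (hS : S ≠ 0) (hT : T ≠ 0) (hST : S ≠ T) : prWeil W h2 S T = -1 :=
  coe_toMul_commForm_heisenbergGm W h2 hS hT hST

/-- `e₂(T, T) = 1` (alternating). [cite: SilvermanAEC2009, III.§8 (the Weil pairing is alternating)] -/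
@[simp] theorem prWeil_self (T : geomTorsion W 2) : prWeil W h2 T T = 1 := by
  simp [prWeil]

/-- `e₂(O, T) = 1`. [cite: SilvermanAEC2009, III.§8 (the Weil pairing is bilinear)] -/
@[simp] theorem prWeil_zero_left (T : geomTorsion W 2) : prWeil W h2 0 T = 1 := by
  simp [prWeil]

/-- `e₂(S, O) = 1`. [cite: SilvermanAEC2009, III.§8 (the Weil pairing is bilinear)] -/
@[simp] theorem prWeil_zero_right (S : geomTorsion W 2) : prWeil W h2 S 0 = 1 := by
  simp [prWeil]

/-- `e₂(S, T)² = 1` (values in `μ₂`). [cite: SilvermanAEC2009, III.§8 (e_m takes values in μ_m)] -/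
theorem prWeil_sq (S T : geomTorsion W 2) : prWeil W h2 S T ^ 2 = 1 := by
  by_cases hS : S = 0
  · subst hS; simp
  by_cases hT : T = 0
  · subst hT; simp
  by_cases hST : S = T
  · subst hST; simp
  rw [prWeil_of_ne W h2 hS hT hST]; norm_num

/-- `e₂` is multiplicative in the first variable. [cite: SilvermanAEC2009, III.§8 (the Weil pairing is bilinear)] -/
theorem prWeil_add_left (S₁ S₂ T : geomTorsion W 2) :
    prWeil W h2 (S₁ + S₂) T = prWeil W h2 S₁ T * prWeil W h2 S₂ T := by
  simp only [prWeil, HeisenbergDatum.commForm_add_left, toMul_add, Units.val_mul]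

/-- `e₂` is multiplicative in the second variable. [cite: SilvermanAEC2009, III.§8 (the Weil pairing is bilinear)] -/
theorem prWeil_add_right (S T₁ T₂ : geomTorsion W 2) :
    prWeil W h2 S (T₁ + T₂) = prWeil W h2 S T₁ * prWeil W h2 S T₂ := by
  simp only [prWeil, HeisenbergDatum.commForm_add_right, toMul_add, Units.val_mul]

/-- `e₂` is Galois equivariant: `σ e₂(S, T) = e₂(σS, σT)`. [cite: SilvermanAEC2009, III.§8 (the Weil pairing is Galois invariant)] -/
theorem smul_prWeil (σ : absoluteGaloisGroup K) (S T : geomTorsion W 2) :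
    σ • prWeil W h2 S T = prWeil W h2 (σ • S) (σ • T) := by
  simp only [prWeil]
  rw [← coe_toMul_heisenbergGm_α W h2 σ, HeisenbergDatum.α_commForm, heisenbergGm_ρ_apply, heisenbergGm_ρ_apply]

/-- `e₂` is non-degenerate: if `e₂(S, T) = 1` for all `S` then `T = O` (uses `char K ≠ 2`).
[cite: SilvermanAEC2009, III.§8 (the Weil pairing is nondegenerate)] -/
theorem eq_zero_of_prWeil_eq_one (T : geomTorsion W 2) (h : ∀ S, prWeil W h2 S T = 1) : T = 0 := by
  by_contra hT
  -- a nonzero `S ≠ T`: one of `T₀, T₁` in the frame works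
  have hneg : (-1 : AlgebraicClosure K) ≠ 1 := by
    intro h1
    apply h2
    have h2' : (2 : AlgebraicClosure K) = 0 := by linear_combination -h1
    have := (algebraMap K (AlgebraicClosure K)).injective (a₁ := 2) (a₂ := 0) (by rw [map_ofNat, map_zero, h2'])
    exact this
  rcases eq_zero_or_eq_T W h2 T with h0 | ⟨i, rfl⟩
  · exact hT h0
  -- pick `j ≠ i`
  obtain ⟨j, hj⟩ : ∃ j : Fin 3, j ≠ i := ⟨i + 1, by fin_cases i <;> decide⟩
  have hS : T W h2 j ≠ 0 := fun h' =>
    DokchitserDokchitser2012.coe_T_ne_zero W h2 j (by rw [h', ZeroMemClass.coe_zero])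
  have hST : T W h2 j ≠ T W h2 i := fun h' => hj (DokchitserDokchitser2012.T_injective W h2 h')
  have := h (T W h2 j)
  rw [prWeil_of_ne W h2 hS hT hST] at this
  exact hneg this

/-- The level-`((2 : ℕ) : ℤ)` reading of `e₂` (same function). [cite: PoonenRains2012, Prop. 4.5 (c) (the commutator pairing of the Heisenberg group is e_λ)] -/
def prWeilN : geomTorsion W ((2 : ℕ) : ℤ) → geomTorsion W ((2 : ℕ) : ℤ) → AlgebraicClosure K :=
  fun S T => prWeil W h2 (show geomTorsion W 2 from S) (show geomTorsion W 2 from T)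

/-- `prWeilN` has the six Weil-pairing properties, (1) `e² = 1`. [cite: SilvermanAEC2009, III.§8 (properties of the Weil pairing)] -/
theorem prWeilN_sq (S T : geomTorsion W ((2 : ℕ) : ℤ)) : prWeilN W h2 S T ^ 2 = 1 := prWeil_sq W h2 _ _

/-- (2) multiplicative on the left. [cite: SilvermanAEC2009, III.§8 (properties of the Weil pairing)] -/
theorem prWeilN_add_left (S₁ S₂ T : geomTorsion W ((2 : ℕ) : ℤ)) :
    prWeilN W h2 (S₁ + S₂) T = prWeilN W h2 S₁ T * prWeilN W h2 S₂ T := prWeil_add_left W h2 _ _ _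

/-- (3) multiplicative on the right. [cite: SilvermanAEC2009, III.§8 (properties of the Weil pairing)] -/
theorem prWeilN_add_right (S T₁ T₂ : geomTorsion W ((2 : ℕ) : ℤ)) :
    prWeilN W h2 S (T₁ + T₂) = prWeilN W h2 S T₁ * prWeilN W h2 S T₂ := prWeil_add_right W h2 _ _ _

/-- (4) Galois equivariant. [cite: SilvermanAEC2009, III.§8 (properties of the Weil pairing)] -/
theorem smul_prWeilN (σ : absoluteGaloisGroup K) (S T : geomTorsion W ((2 : ℕ) : ℤ)) :
    σ • prWeilN W h2 S T = prWeilN W h2 (σ • S) (σ • T) := smul_prWeil W h2 σ _ _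

/-- (5) alternating. [cite: SilvermanAEC2009, III.§8 (properties of the Weil pairing)] -/
theorem prWeilN_self (T : geomTorsion W ((2 : ℕ) : ℤ)) : prWeilN W h2 T T = 1 := prWeil_self W h2 _

/-- (6) non-degenerate. [cite: SilvermanAEC2009, III.§8 (properties of the Weil pairing)] -/
theorem eq_zero_of_prWeilN_eq_one (T : geomTorsion W ((2 : ℕ) : ℤ)) (h : ∀ S, prWeilN W h2 S T = 1) : T = 0 :=
  eq_zero_of_prWeil_eq_one W h2 _ h

end Weil

/-! ### The local Tate quadratic forms `q_v = inv_v ∘ q_{K_v}` over a number field -/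

section NumberField

-- Cup products need `LocallyCompactSpace Γ_{K_v}`; as in `WeilPairingTateDual.lean` / `LocalTatePairing.lean`,
-- the compactness of absolute Galois groups is a local instance only.
attribute [local instance] absoluteGaloisGroup_compactSpace

-- `char K_v = 0` (tree theorem `Literature.NumberTheory.EllipticCurves.charZero_placeCompletion`), as a local instance.
attribute [local instance] Literature.NumberTheory.EllipticCurves.charZero_placeCompletion

variable {K : Type} [Field K] [NumberField K] (W : WeierstrassCurve K) [W.IsElliptic] (h2 : (2 : K) ≠ 0)

/-- **Poonen–Rains' Tate quadratic form at a place `v`**: `q_v(x) = inv_v(q_{K_v}(x)) ∈ ℤ/2` for THE canonical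
invariant map `inv_v : H²(K_v, μ₂) → ℤ/2` (level spelled `((2 : ℕ) : ℤ)` on the input, as in the KMR bridge).
[cite: PoonenRains2012, Thm. 4.14 (the q_v form a global metabolic structure)] -/
def prForm (v : Place K) (x : galoisCohomology ((W.torsionGaloisModule ((2 : ℕ) : ℤ)).toLocal v) 1) : ZMod 2 :=
  LocalInvariants.canonical K 2 v
    (prClass W h2 (Place.Completion v) (show galoisCohomology ((W.torsionGaloisModule (2 : ℤ)).toLocal v) 1 from x))

/-! #### (Q2): `q_v` kills the Kummer condition -/

/-- **(Q2) Kummer isotropy in the KMR currency**: `q_v(x) = 0` for every `x` in the Kummer local condition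
`𝓚_v ⊂ H¹(K_v, E[2])` (every such `x` is a local Kummer class `κ(Q)`, `2Q ∈ E(K_v)`, by exactness of the
local Kummer sequence, and `q_{K_v}(κ(Q)) = 0` by `prClass_localKummerClass`).
[cite: PoonenRains2012, Prop. 4.8 (the image of A(k)/λA(k) is isotropic for q)] -/
theorem prForm_eq_zero_of_mem_kummer (v : Place K)
    (x : galoisCohomology ((W.torsionGaloisModule ((2 : ℕ) : ℤ)).toLocal v) 1)
    (hx : x ∈ W.kummerSelmerStructure ((2 : ℕ) : ℤ) v) : prForm W h2 v x = 0 := by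
  rw [kummerSelmerStructure_apply] at hx
  obtain ⟨Q, hQ, rfl⟩ := W.exists_eq_localKummerClass_of_mem ((2 : ℕ) : ℤ) (by norm_num) hx
  unfold prForm
  have key := prClass_localKummerClass W h2 (Place.Completion v) Q hQ
  rw [← (LocalInvariants.canonical K 2 v).map_zero]
  congr 1

/-! #### (Q1): the polar form of `q_v` is `inv_v` of the Weil cup product -/

/-- The two level-`2` cup-product pairings on `H¹(K_v, E[2])` agree on cocycles: the commutator pairing of
the Heisenberg datum (`weilPairingTwo`) and the tree's `weilContPairingLocal` for `e₂ = prWeilN`.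
[cite: PoonenRains2012, §4.1 (∪_{e_λ})] -/
theorem cupCocycle_weilPairingTwo_eq (v : Place K)
    (ξ η : contOneCocycles (DiscreteGaloisModule.toTopRep
      (GaloisRep.restrictField (Place.Completion v) (W.torsionGaloisModule 2)))) :
    (weilPairingTwo W h2 (Place.Completion v)).cupCocycle ξ η
      = (weilContPairingLocal W 2 (prWeilN W h2) (prWeilN_sq W h2) (prWeilN_add_left W h2)
          (prWeilN_add_right W h2) (smul_prWeilN W h2) v).cupCocycle ξ η := by
  apply Subtype.ext
  apply ContinuousMap.ext
  rintro ⟨σ, τ⟩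
  rw [ContPairing.cupCocycle_apply, ContPairing.cupCocycle_apply, weilPairingTwo_toLin,
    weilContPairingLocal_toLin_apply]
  apply muVal_injective K 2
  apply Units.ext
  show (((Additive.toMul (MuCarrier.toAdditive ((localDatum W h2 (Place.Completion v)).commForm _ _)) :
      rootsOfUnity 2 (AlgebraicClosure K)) : (AlgebraicClosure K)ˣ) : AlgebraicClosure K)
    = (((Additive.toMul (MuCarrier.toAdditive (weilPairingHom W 2 (prWeilN W h2) (prWeilN_sq W h2)
        (prWeilN_add_left W h2) (prWeilN_add_right W h2) _ _)) : rootsOfUnity 2 (AlgebraicClosure K)) :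
        (AlgebraicClosure K)ˣ) : AlgebraicClosure K)
  rw [coe_weilPairingHom]
  simp only [localDatum, HeisenbergDatum.commForm_comap, heisenbergMu, HeisenbergDatum.commForm_mapValues,
    coe_muTwoToCarrier, HeisenbergDatum.coe_commForm_codRestrict]
  rfl

/-- The two level-`2` cup products on `H¹(K_v, E[2])` agree on classes.
[cite: PoonenRains2012, §4.1 (∪_{e_λ})] -/
theorem weilCup_eq_cupProduct (v : Place K)
    (a b : galoisCohomology (GaloisRep.restrictField (Place.Completion v) (W.torsionGaloisModule 2)) 1) :
    weilCup W h2 (Place.Completion v) a b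
      = (weilContPairingLocal W 2 (prWeilN W h2) (prWeilN_sq W h2) (prWeilN_add_left W h2)
          (prWeilN_add_right W h2) (smul_prWeilN W h2) v).cupProduct
          (show galoisCohomology ((W.torsionGaloisModule (2 : ℤ)).toLocal v) 1 from a)
          (show galoisCohomology ((W.torsionGaloisModule (2 : ℤ)).toLocal v) 1 from b) := by
  obtain ⟨ξ, rfl⟩ := oneCocycleClass_surjective _ a
  obtain ⟨η, rfl⟩ := oneCocycleClass_surjective _ b
  rw [weilCup_oneCocycleClass, cupCocycle_weilPairingTwo_eq]
  exact (ContPairing.cupProduct_oneCocycleClass_eq_twoCocycleClass _ ξ η).symm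

/-- **(Q1) The polar form of `q_v` is `inv_v` of the Weil cup product** (KMR Def. 3.2: `q_v` is a Tate quadratic
form): `q_v(x + y) = q_v(x) + q_v(y) + inv_v(x ∪_{e₂} y)` for the cup product of the tree's
`weilContPairingLocal W 2 e₂` and THE canonical invariant map (`prClass_add`, `weilCup_comm`, `weilCup_eq_cupProduct`).
[cite: PoonenRains2012, Cor. 4.6 (q is a quadratic form whose associated bilinear pairing is ∪_{e_λ})] -/
theorem prForm_add (v : Place K) (x y : galoisCohomology ((W.torsionGaloisModule ((2 : ℕ) : ℤ)).toLocal v) 1) :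
    prForm W h2 v (x + y) = prForm W h2 v x + prForm W h2 v y
      + LocalInvariants.canonical K 2 v
          ((weilContPairingLocal W 2 (prWeilN W h2) (prWeilN_sq W h2) (prWeilN_add_left W h2)
            (prWeilN_add_right W h2) (smul_prWeilN W h2) v).cupProduct x y) := by
  have hcan : ∀ a b : galoisCohomology (GaloisRep.restrictField (Place.Completion v) (mu K 2)) 2,
      LocalInvariants.canonical K 2 v (a + b) = LocalInvariants.canonical K 2 v a + LocalInvariants.canonical K 2 v b :=
    fun a b => (LocalInvariants.canonical K 2 v).map_add a b
  show LocalInvariants.canonical K 2 v (prClass W h2 (Place.Completion v)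
      ((show galoisCohomology (GaloisRep.restrictField (Place.Completion v) (W.torsionGaloisModule 2)) 1 from x)
        + (show galoisCohomology (GaloisRep.restrictField (Place.Completion v) (W.torsionGaloisModule 2)) 1 from y)))
    = LocalInvariants.canonical K 2 v (prClass W h2 (Place.Completion v)
        (show galoisCohomology (GaloisRep.restrictField (Place.Completion v) (W.torsionGaloisModule 2)) 1 from x))
      + LocalInvariants.canonical K 2 v (prClass W h2 (Place.Completion v)
        (show galoisCohomology (GaloisRep.restrictField (Place.Completion v) (W.torsionGaloisModule 2)) 1 from y))
      + LocalInvariants.canonical K 2 v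
          ((weilContPairingLocal W 2 (prWeilN W h2) (prWeilN_sq W h2) (prWeilN_add_left W h2)
            (prWeilN_add_right W h2) (smul_prWeilN W h2) v).cupProduct x y)
  rw [prClass_add, hcan, hcan, weilCup_comm, weilCup_eq_cupProduct]

end NumberField

end ThetaLevelTwo

end Literature.NumberTheory.EllipticCurves
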